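import Literature.Probability.LatticeModels.ModifiedSimonInequality
import Literature.Probability.LatticeModels.IsingTransport
import Literature.Probability.LatticeModels.TreeGraphWickPairInteraction
import Literature.Probability.LatticeModels.AizenmanWickBoundCouplings
import Literature.Probability.LatticeModels.GKSInequalities
import HarnessLib

/-!
# The Lieb–Simon inequality for general ferromagnetic pair interactions on a finite set

Proofs-only file (topic `Literature/Probability/LatticeModels`; theorems only, no definition, no
named fact). Simon's inequality with Lieb's improvement (Simon 1980, Thm. (1.3); Lieb 1980, eq. (4);
in the finite-volume `tanh` form of Duminil-Copin–Tassion 2016, Lemma 2.7, PROVED in the tree for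
UNIT couplings on graphs as `isingTwoPoint_free_le_modifiedSimon`) is moved to a general nonnegative
pair coupling `c` on a finite set `ι` (Gibbs weight `exp(∑_{a,b} c_{ab}σ_aσ_b)`, the `PairIsing.avg`
of `GaussianPairingBoundCouplings`), through the decorated graphs `PairIsing.decorGraph k` of that
file:

* `PairIsing.liebSimon` — for `a ∈ B`, `z ∉ B`,
  `⟨σ_aσ_z⟩_c ≤ ∑_{u ∈ B} ∑_{v ∉ B} (c_{uv} + c_{vu}) ⟨σ_aσ_u⟩_{c|_B} (⟨σ_uσ_z⟩_c + ⟨σ_vσ_z⟩_c)`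
  (two-sided outer factor; `c_{uv} + c_{vu}` is the coupling of the pair `{u,v}`);
* `PairIsing.liebSimon_full` — the same with the full state `⟨σ_aσ_u⟩_c` in the first factor
  (the form of Aizenman–Duminil-Copin 2021, Lemma 5.7, eq. (5.22): "being spin-dimension balanced,
  it is valid also for the Griffiths–Simon class of variables and more general pair interactions"),
  via `PairIsing.avg_restrict_spinPair_le` (`⟨σ_aσ_b⟩_{c|_B} ≤ ⟨σ_aσ_b⟩_c`, Griffiths).

Proof of `PairIsing.liebSimon`: on `decorGraph k` (decorated couplings `K(β₀)k`) take the volume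
`S'` = sites of `B` + decorations with both ends in `B`, whose free state is the decorated model of
`k|_B` (`PairIsing.decor_restrict_transport`, by `isingExpect_free_map`); the modified Simon
inequality with `(S', univ)` has boundary terms exactly at the decorations crossing `∂B`, and a second
application with the one-point volume of such a decoration bounds `⟨σ_sσ_z⟩ ≤ tanh β₀(⟨σ_{s₁}σ_z⟩ +
⟨σ_{s₂}σ_z⟩)` (`PairIsing.liebSimon_decor`); then `K_m⌊c/K_m⌋₊ → c`, `β₀ = 1/(m+1) → 0`, with the
elementary `tanh²x ≤ (1 + tanh²x)K(x)` (`tanh_sq_le_mul_decorK`) and continuity of the averages.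
The block-variable / lattice `φ⁴` transfer is in `MathematicalPhysics/QuantumLattice/Phi4LiebSimon.lean`.

## References

* B. Simon, Comm. Math. Phys. 77 (1980) 111–126, Thm. (1.3); E. H. Lieb, Comm. Math. Phys. 77
  (1980) 127–135, eq. (4).
* H. Duminil-Copin, V. Tassion, Comm. Math. Phys. 343 (2016) 725–745, Lemma 2.7.
  [DuminilCopinTassionCMP2016]
* M. Aizenman, H. Duminil-Copin, Ann. of Math. 194 (2021), Lemma 5.7, eq. (5.22).
  [AizenmanDuminilCopinAnnals2021]
* S. Friedli, Y. Velenik (2017), Exercise 3.12 (volume monotonicity). [FriedliVelenik2017]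
-/

noncomputable section

open MeasureTheory Filter Topology Finset
open scoped symmDiff

namespace Literature.Probability.LatticeModels

/-! ### Part A. An elementary bound: `tanh² x ≤ (1 + tanh² x) K(x)`, `K(x) = ½ log cosh 2x` -/

section Analysis

/-- `tanh² x ≤ (1 + tanh² x) · ½ log cosh(2x)`: with `u = tanh² x`, `cosh 2x = (1+u)/(1-u)` and
`log y ≥ 1 - y⁻¹`. [folklore] -/
theorem tanh_sq_le_mul_decorK (x : ℝ) :
    Real.tanh x ^ 2 ≤ (1 + Real.tanh x ^ 2) * PairIsing.decorK x := by
  have hc : 0 < Real.cosh x := Real.cosh_pos x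
  set u : ℝ := Real.tanh x ^ 2 with hu
  have hu' : u = Real.sinh x ^ 2 / Real.cosh x ^ 2 := by
    rw [hu, Real.tanh_eq_sinh_div_cosh, div_pow]
  have hu0 : 0 ≤ u := sq_nonneg _
  have hu1 : u < 1 := by
    rw [hu', div_lt_one (by positivity), Real.cosh_sq]
    linarith
  -- `cosh 2x = (1 + u)/(1 - u)`
  have hcosh : Real.cosh (2 * x) = (1 + u) / (1 - u) := by
    rw [Real.cosh_two_mul, hu', eq_div_iff (by
      have : Real.sinh x ^ 2 / Real.cosh x ^ 2 < 1 := by rwa [← hu']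
      linarith)]
    field_simp
    nlinarith [Real.cosh_sq x]
  have hy : 0 < (1 + u) / (1 - u) := div_pos (by linarith) (by linarith)
  have hlog : 2 * u / (1 + u) ≤ Real.log ((1 + u) / (1 - u)) := by
    have h := Real.one_sub_inv_le_log_of_pos hy
    have : 1 - ((1 + u) / (1 - u))⁻¹ = 2 * u / (1 + u) := by
      rw [inv_div]
      field_simp
      ring
    rwa [this] at h
  unfold PairIsing.decorK
  rw [hcosh]
  have h1u : 0 < 1 + u := by linarith
  calc u = (1 + u) * (2 * u / (1 + u) / 2) := by field_simp
    _ ≤ (1 + u) * (Real.log ((1 + u) / (1 - u)) / 2) :=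
        mul_le_mul_of_nonneg_left (by linarith) h1u.le

end Analysis

/-! ### Part B. Pair-interaction Ising models -/

section PairIsingLiebSimon

variable {ι : Type} [Fintype ι] [DecidableEq ι]

/-- `⟨σ_{inl a}σ_{inl b}⟩` in the decorated model is the pair-interaction average. [folklore] -/
theorem isingTwoPoint_decorGraph_inl {k : ι → ι → ℕ} (hk : ∀ a, k a a = 0) (β₀ : ℝ) (a b : ι) :
    isingTwoPoint (PairIsing.decorGraph k) univ β₀ 0 .free (Sum.inl a) (Sum.inl b) =
      PairIsing.avg (fun a b => PairIsing.decorK β₀ * k a b) (spinPair a b) :=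
  PairIsing.twoPoint_decorGraph_inl hk β₀ a b

/-- **The decorated model of the restricted couplings is a finite-volume state of the decorated
graph**: for `k` with zero diagonal and `B ⊆ ι` there is a volume `S'` of `decorGraph k` — the sites
of `B` and the decorations with both ends in `B` — whose free state restricted to the sites is the
decorated model of `k|_B` (`isingExpect_free_map` along the embedding of `decorGraph (k|_B)`). [folklore] -/
theorem PairIsing.decor_restrict_transport {k : ι → ι → ℕ} (hk : ∀ a, k a a = 0) (β₀ : ℝ)
    (B : Finset ι) :
    ∃ S' : Finset (ι ⊕ PairIsing.Decor k),
      (∀ u : ι, Sum.inl u ∈ S' ↔ u ∈ B) ∧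
      (∀ s : PairIsing.Decor k, Sum.inr s ∈ S' ↔ (s.1 ∈ B ∧ s.2.1 ∈ B)) ∧
      (∀ F : (ι ⊕ PairIsing.Decor k) → ℝ, (∀ s : PairIsing.Decor k, s.1 ∈ B → s.2.1 ∈ B →
          F (Sum.inr s) = 0) → ∑ x ∈ S', F x = ∑ u ∈ B, F (Sum.inl u)) ∧
      ∀ a b : ↥B, isingTwoPoint (PairIsing.decorGraph k) S' β₀ 0 .free (Sum.inl a.1) (Sum.inl b.1) =
        PairIsing.avg (fun a' b' : ↥B => PairIsing.decorK β₀ * k a' b') (spinPair a b) := by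
  classical
  set G' : SimpleGraph (ι ⊕ PairIsing.Decor k) := PairIsing.decorGraph k with hG'
  set kB : ↥B → ↥B → ℕ := fun a b => k a b with hkB
  have hkB0 : ∀ a, kB a a = 0 := fun a => hk a
  set GB : SimpleGraph (↥B ⊕ PairIsing.Decor kB) := PairIsing.decorGraph kB with hGB
  let φf : (↥B ⊕ PairIsing.Decor kB) → (ι ⊕ PairIsing.Decor k) := fun x =>
    match x with
    | Sum.inl b => Sum.inl b.1
    | Sum.inr s => Sum.inr ⟨s.1.1, s.2.1.1, s.2.2⟩
  have hφinj : Function.Injective φf := by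
    rintro (b | ⟨a, b, i⟩) (b' | ⟨a', b', i'⟩) h
    · simp only [φf, Sum.inl.injEq] at h
      rw [Subtype.ext h]
    · simp [φf] at h
    · simp [φf] at h
    · simp only [φf, Sum.inr.injEq, Sigma.mk.inj_iff] at h
      obtain ⟨h1, h2⟩ := h
      have ha : a = a' := Subtype.ext h1
      subst ha
      simp only [heq_eq_eq, Sigma.mk.inj_iff] at h2
      obtain ⟨h2, h3⟩ := h2
      have hb : b = b' := Subtype.ext h2
      subst hb
      simp only [heq_eq_eq] at h3
      subst h3
      rfl
  let φ : (↥B ⊕ PairIsing.Decor kB) ↪ (ι ⊕ PairIsing.Decor k) := ⟨φf, hφinj⟩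
  have hφl : ∀ b : ↥B, φ (Sum.inl b) = Sum.inl b.1 := fun b => rfl
  have hφr : ∀ s : PairIsing.Decor kB, φ (Sum.inr s) = Sum.inr ⟨s.1.1, s.2.1.1, s.2.2⟩ := fun s => rfl
  have hadj : ∀ x ∈ (univ : Finset (↥B ⊕ PairIsing.Decor kB)), ∀ y ∈ (univ : Finset _),
      (G'.Adj (φ x) (φ y) ↔ GB.Adj x y) := by
    rintro (b | s) - (b' | s') -
    · simp [hφl, hG', hGB]
    · rw [hφl, hφr, hG', hGB, PairIsing.decorGraph_adj_inl_inr, PairIsing.decorGraph_adj_inl_inr]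
      simp only [Subtype.ext_iff]
    · rw [hφl, hφr, hG', hGB, PairIsing.decorGraph_adj_inr_inl, PairIsing.decorGraph_adj_inr_inl]
      simp only [Subtype.ext_iff]
    · simp [hφr, hG', hGB]
  refine ⟨(univ : Finset (↥B ⊕ PairIsing.Decor kB)).map φ, fun u => ?_, fun s => ?_,
    fun F hF => ?_, fun a b => ?_⟩
  · rw [Finset.mem_map]
    constructor
    · rintro ⟨x, -, hx⟩
      rcases x with b | s
      · rw [hφl] at hx
        cases hx
        exact b.2
      · rw [hφr] at hx
        cases hx
    · intro hu
      exact ⟨Sum.inl ⟨u, hu⟩, Finset.mem_univ _, rfl⟩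
  · rw [Finset.mem_map]
    constructor
    · rintro ⟨x, -, hx⟩
      rcases x with b | t
      · rw [hφl] at hx
        cases hx
      · rw [hφr] at hx
        simp only [Sum.inr.injEq] at hx
        subst hx
        exact ⟨t.1.2, t.2.1.2⟩
    · rintro ⟨h1, h2⟩
      refine ⟨Sum.inr ⟨⟨s.1, h1⟩, ⟨s.2.1, h2⟩, s.2.2⟩, Finset.mem_univ _, ?_⟩
      rw [hφr]
  · rw [Finset.sum_map, Fintype.sum_sum_type]
    have h0 : ∑ t : PairIsing.Decor kB, F (φ (Sum.inr t)) = 0 :=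
      Finset.sum_eq_zero fun t _ => by rw [hφr]; exact hF _ t.1.2 t.2.1.2
    rw [h0, add_zero, ← Finset.sum_coe_sort B]
    rfl
  · rw [← isingTwoPoint_decorGraph_inl hkB0 β₀ a b]
    unfold isingTwoPoint
    rw [isingExpect_free_map φ hadj β₀ 0 (measurable_spinPair _ _)]
    congr 1
    funext σ
    rw [show (Sum.inl a.1 : ι ⊕ PairIsing.Decor k) = φ (Sum.inl a) from rfl,
      show (Sum.inl b.1 : ι ⊕ PairIsing.Decor k) = φ (Sum.inl b) from rfl]
    simp only [spinPair, spinAt_extendAlong]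

/-- **The Lieb–Simon inequality for decorated couplings** `K(β₀)·k` (`k` integer, zero diagonal,
`β₀ ≥ 0`), two-sided form: for `a ∈ B`, `z ∉ B`,
`⟨σ_aσ_z⟩ ≤ ∑_{u ∈ B} ∑_{v ∉ B} (k_{uv} + k_{vu}) tanh²β₀ ⟨σ_aσ_u⟩_{B} (⟨σ_uσ_z⟩ + ⟨σ_vσ_z⟩)` — the
modified Simon inequality (`isingTwoPoint_free_le_modifiedSimon`) on the decorated graph with the
volume `S` = sites of `B` and the decorations internal to `B` (whose free state is the decorated model
of `k|_B`, `isingExpect_free_map`), followed by the modified Simon inequality at the one-point volumes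
of the crossing decorations. [cite: DuminilCopinTassionCMP2016, Lemma 2.7] -/
theorem PairIsing.liebSimon_decor {k : ι → ι → ℕ} (hk : ∀ a, k a a = 0) {β₀ : ℝ} (hβ₀ : 0 ≤ β₀)
    (B : Finset ι) {a z : ι} (ha : a ∈ B) (hz : z ∉ B) :
    PairIsing.avg (fun a b => PairIsing.decorK β₀ * k a b) (spinPair a z) ≤
      ∑ u : ↥B, ∑ v ∈ Bᶜ, ((k u v + k v u : ℕ) : ℝ) * Real.tanh β₀ ^ 2 *
        PairIsing.avg (fun a' b' : ↥B => PairIsing.decorK β₀ * k a' b') (spinPair ⟨a, ha⟩ u) *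
        (PairIsing.avg (fun a b => PairIsing.decorK β₀ * k a b) (spinPair (u : ι) z) +
          PairIsing.avg (fun a b => PairIsing.decorK β₀ * k a b) (spinPair v z)) := by
  classical
  -- notation
  set G' : SimpleGraph (ι ⊕ PairIsing.Decor k) := PairIsing.decorGraph k with hG'
  obtain ⟨S', hmem_inl, hmem_inr, hsplit, hTS⟩ := PairIsing.decor_restrict_transport hk β₀ B
  -- abbreviations for the correlation functions
  set T : (ι ⊕ PairIsing.Decor k) → (ι ⊕ PairIsing.Decor k) → ℝ :=
    fun x y => isingTwoPoint G' univ β₀ 0 .free x y with hT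
  set TS : (ι ⊕ PairIsing.Decor k) → (ι ⊕ PairIsing.Decor k) → ℝ :=
    fun x y => isingTwoPoint G' S' β₀ 0 .free x y with hTS'
  have hT_inl : ∀ p q : ι, T (Sum.inl p) (Sum.inl q) =
      PairIsing.avg (fun a b => PairIsing.decorK β₀ * k a b) (spinPair p q) := fun p q =>
    isingTwoPoint_decorGraph_inl hk β₀ p q
  have hTS_inl : ∀ b : ↥B, TS (Sum.inl a) (Sum.inl b.1) =
      PairIsing.avg (fun a' b' : ↥B => PairIsing.decorK β₀ * k a' b') (spinPair ⟨a, ha⟩ b) :=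
    fun b => hTS ⟨a, ha⟩ b
  -- Step 1: the modified Simon inequality with volume `S'`
  have haS : (Sum.inl a : ι ⊕ PairIsing.Decor k) ∈ S' := (hmem_inl a).2 ha
  have hzS : (Sum.inl z : ι ⊕ PairIsing.Decor k) ∉ S' := fun h => hz ((hmem_inl z).1 h)
  have h1 := isingTwoPoint_free_le_modifiedSimon G' hβ₀ (Finset.subset_univ S') haS
    (Finset.mem_univ (Sum.inl z)) hzS
  -- Step 2: one-point volumes at the decorations
  have h2 : ∀ s : PairIsing.Decor k, T (Sum.inr s) (Sum.inl z) ≤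
      Real.tanh β₀ * (T (Sum.inl s.1) (Sum.inl z) + T (Sum.inl s.2.1) (Sum.inl z)) := by
    intro s
    have hne : s.1 ≠ s.2.1 := PairIsing.Decor.fst_ne hk s
    have h := isingTwoPoint_free_le_modifiedSimon G' hβ₀ (Finset.subset_univ {Sum.inr s})
      (Finset.mem_singleton_self (Sum.inr s)) (Finset.mem_univ (Sum.inl z)) (by simp)
    rw [Finset.sum_singleton] at h
    have hfilter : (univ \ {Sum.inr s}).filter (G'.Adj (Sum.inr s)) =
        ({Sum.inl s.1, Sum.inl s.2.1} : Finset (ι ⊕ PairIsing.Decor k)) := by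
      ext y
      rcases y with w | t
      · simp [hG', PairIsing.decorGraph_adj_inr_inl]
      · simp [hG']
    rw [hfilter, Finset.sum_pair (by simpa using hne), isingTwoPoint_self] at h
    calc T (Sum.inr s) (Sum.inl z) ≤ _ := h
      _ = Real.tanh β₀ * (T (Sum.inl s.1) (Sum.inl z) + T (Sum.inl s.2.1) (Sum.inl z)) := by
          rw [hT]; ring
  -- Step 3: the right-hand side of `h1`
  rw [show isingTwoPoint G' univ β₀ 0 .free (Sum.inl a) (Sum.inl z) =
    PairIsing.avg (fun a b => PairIsing.decorK β₀ * k a b) (spinPair a z) from hT_inl a z] at h1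
  refine h1.trans ?_
  -- decorations internal to `B` contribute nothing
  have hint0 : ∀ s : PairIsing.Decor k, s.1 ∈ B → s.2.1 ∈ B →
      (∑ y ∈ (univ \ S').filter (G'.Adj (Sum.inr s)),
        Real.tanh β₀ * isingTwoPoint G' S' β₀ 0 .free (Sum.inl a) (Sum.inr s) *
          isingTwoPoint G' univ β₀ 0 .free y (Sum.inl z)) = 0 := by
    intro s hs1 hs2
    refine Finset.sum_eq_zero fun y hy => ?_
    exfalso
    rw [Finset.mem_filter, Finset.mem_sdiff] at hy
    obtain ⟨⟨-, hyS⟩, hadj'⟩ := hy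
    rcases y with w | t'
    · rw [hG', PairIsing.decorGraph_adj_inr_inl] at hadj'
      apply hyS
      rw [hmem_inl]
      rcases hadj' with rfl | rfl
      · exact hs1
      · exact hs2
    · exact PairIsing.decorGraph_not_adj_inr_inr _ _ _ hadj'
  rw [hsplit _ hint0, ← Finset.sum_coe_sort B]
  -- sites of `B`
  refine Finset.sum_le_sum fun b _ => ?_
  have htanh : 0 ≤ Real.tanh β₀ := by
    rw [Real.tanh_eq_sinh_div_cosh]
    exact div_nonneg (Real.sinh_nonneg_iff.2 hβ₀) (Real.cosh_pos _).le
  have hA0 : 0 ≤ TS (Sum.inl a) (Sum.inl b.1) := by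
    rw [hTS_inl b]
    exact (PairIsing.avg_spinPair_mem _ (fun a' b' => mul_nonneg (PairIsing.decorK_nonneg _)
      (Nat.cast_nonneg _)) _ _).1
  -- the boundary neighbours of `inl b` are the crossing decorations at `b`
  set Cross : Finset (PairIsing.Decor k) :=
    univ.filter (fun s => (s.1 = b.1 ∧ s.2.1 ∉ B) ∨ (s.2.1 = b.1 ∧ s.1 ∉ B)) with hCross
  have hfilt : (univ \ S').filter (G'.Adj (Sum.inl b.1)) =
      Cross.map ⟨Sum.inr, Sum.inr_injective⟩ := by
    ext y
    simp only [Finset.mem_filter, Finset.mem_sdiff, Finset.mem_map, Finset.mem_univ, true_and,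
      Function.Embedding.coeFn_mk]
    constructor
    · rintro ⟨hyS, hadj'⟩
      rcases y with w | s
      · exact absurd hadj' (PairIsing.decorGraph_not_adj_inl_inl _ _ _)
      · refine ⟨s, ?_, rfl⟩
        rw [hCross, Finset.mem_filter]
        refine ⟨Finset.mem_univ _, ?_⟩
        rw [hG', PairIsing.decorGraph_adj_inl_inr] at hadj'
        rw [hmem_inr] at hyS
        rcases hadj' with h1 | h1
        · left
          refine ⟨h1.symm, fun h2 => hyS ⟨?_, h2⟩⟩
          rw [← h1]; exact b.2
        · right
          refine ⟨h1.symm, fun h2 => hyS ⟨h2, ?_⟩⟩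
          rw [← h1]; exact b.2
    · rintro ⟨s, hs, rfl⟩
      rw [hCross, Finset.mem_filter] at hs
      obtain ⟨-, hs⟩ := hs
      refine ⟨fun hyS => ?_, ?_⟩
      · rw [hmem_inr] at hyS
        rcases hs with ⟨-, h2⟩ | ⟨-, h2⟩
        · exact h2 hyS.2
        · exact h2 hyS.1
      · show G'.Adj (Sum.inl b.1) (Sum.inr s)
        rw [hG', PairIsing.decorGraph_adj_inl_inr]
        rcases hs with ⟨h1, -⟩ | ⟨h1, -⟩
        · exact Or.inl h1.symm
        · exact Or.inr h1.symm
  rw [hfilt, Finset.sum_map]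
  simp only [Function.Embedding.coeFn_mk]
  -- the summand, as a symmetric function of the two ends of the decoration
  set A : ℝ := TS (Sum.inl a) (Sum.inl b.1) with hA
  set g : ι → ι → ℝ := fun p q => Real.tanh β₀ * A *
    (Real.tanh β₀ * (T (Sum.inl p) (Sum.inl z) + T (Sum.inl q) (Sum.inl z))) with hg
  have hgsymm : ∀ p q, g p q = g q p := fun p q => by simp only [hg]; ring
  -- the combinatorial resummation over the crossing decorations
  have hresum : ∑ s ∈ Cross, g s.1 s.2.1 =
      ∑ v ∈ Bᶜ, ((k b.1 v + k v b.1 : ℕ) : ℝ) * g b.1 v := by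
    rw [hCross, Finset.sum_filter, Fintype.sum_sigma]
    simp_rw [Fintype.sum_sigma]
    -- `∑_p ∑_q ∑_{i < k p q} [P p q] g p q`
    have hinner : ∀ p q : ι, (∑ _i : Fin (k p q),
        if (p = b.1 ∧ q ∉ B) ∨ (q = b.1 ∧ p ∉ B) then g p q else 0) =
        (k p q : ℝ) * (if p = b.1 ∧ q ∉ B then g p q else 0) +
          (k p q : ℝ) * (if q = b.1 ∧ p ∉ B then g p q else 0) := by
      intro p q
      rw [Finset.sum_const, Finset.card_univ, Fintype.card_fin, nsmul_eq_mul, ← mul_add]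
      congr 1
      by_cases h1 : p = b.1 ∧ q ∉ B
      · have h2 : ¬ (q = b.1 ∧ p ∉ B) := fun h2 => h2.2 (h1.1 ▸ b.2)
        rw [if_pos (Or.inl h1), if_pos h1, if_neg h2, add_zero]
      · by_cases h2 : q = b.1 ∧ p ∉ B
        · rw [if_pos (Or.inr h2), if_neg h1, if_pos h2, zero_add]
        · rw [if_neg (not_or.2 ⟨h1, h2⟩), if_neg h1, if_neg h2, add_zero]
    simp_rw [hinner]
    rw [Finset.sum_comm]
    simp_rw [Finset.sum_add_distrib]
    -- first part: `p = b`, `q ∉ B`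
    have hp1 : ∀ q : ι, (∑ p : ι, (k p q : ℝ) * (if p = b.1 ∧ q ∉ B then g p q else 0)) =
        if q ∉ B then (k b.1 q : ℝ) * g b.1 q else 0 := by
      intro q
      by_cases hq : q ∉ B
      · have hc : ∀ p : ι, (if p = b.1 ∧ q ∉ B then g p q else 0) = if p = b.1 then g p q else 0 := by
          intro p
          rcases eq_or_ne p b.1 with hp | hp
          · rw [if_pos ⟨hp, hq⟩, if_pos hp]
          · rw [if_neg (fun h => hp h.1), if_neg hp]
        simp_rw [hc]
        rw [if_pos hq, Finset.sum_eq_single b.1 (fun p _ hp => by rw [if_neg hp, mul_zero])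
          (fun h => absurd (Finset.mem_univ _) h), if_pos rfl]
      · rw [if_neg hq]
        exact Finset.sum_eq_zero fun p _ => by rw [if_neg (fun h => hq h.2), mul_zero]
    -- second part: `q = b`, `p ∉ B`
    have hp2 : ∀ q : ι, (∑ p : ι, (k p q : ℝ) * (if q = b.1 ∧ p ∉ B then g p q else 0)) =
        if q = b.1 then ∑ p ∈ Bᶜ, (k p b.1 : ℝ) * g p b.1 else 0 := by
      intro q
      by_cases hq : q = b.1
      · rw [if_pos hq]
        calc (∑ p, (k p q : ℝ) * if q = b.1 ∧ p ∉ B then g p q else 0)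
            = ∑ p, if p ∉ B then (k p b.1 : ℝ) * g p b.1 else 0 := by
              refine Finset.sum_congr rfl fun p _ => ?_
              by_cases hp : p ∉ B
              · rw [if_pos ⟨hq, hp⟩, if_pos hp, hq]
              · rw [if_neg (fun h => hp h.2), if_neg hp, mul_zero]
          _ = ∑ p ∈ Bᶜ, (k p b.1 : ℝ) * g p b.1 := by
              rw [← Finset.sum_filter]
              exact Finset.sum_congr (by ext p; simp) fun p _ => rfl
      · rw [if_neg hq]
        exact Finset.sum_eq_zero fun p _ => by rw [if_neg (fun h => hq h.1), mul_zero]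
    simp_rw [hp1, hp2]
    rw [Finset.sum_ite_eq' univ b.1, if_pos (Finset.mem_univ _), ← Finset.sum_filter,
      show univ.filter (fun q : ι => q ∉ B) = Bᶜ by ext q; simp, ← Finset.sum_add_distrib]
    refine Finset.sum_congr rfl fun v _ => ?_
    rw [hgsymm v b.1]
    push_cast
    ring
  calc ∑ s ∈ Cross, Real.tanh β₀ * A * T (Sum.inr s) (Sum.inl z)
      ≤ ∑ s ∈ Cross, g s.1 s.2.1 :=
        Finset.sum_le_sum fun s _ => mul_le_mul_of_nonneg_left (h2 s) (mul_nonneg htanh hA0)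
    _ = ∑ v ∈ Bᶜ, ((k b.1 v + k v b.1 : ℕ) : ℝ) * g b.1 v := hresum
    _ = _ := by
        refine Finset.sum_congr rfl fun v _ => ?_
        simp only [hg, hA]
        rw [hTS_inl b, hT_inl, hT_inl]
        ring

omit [Fintype ι] in
/-- The decorated approximation with explicit `β₀(m) = 1/(m+1)` (as in
`PairIsing.exists_decor_approx`, whose `β₀` is hidden behind the existential). [folklore] -/
theorem PairIsing.exists_decor_approx_explicit (c : ι → ι → ℝ) (hc : ∀ a b, a ≠ b → 0 ≤ c a b) :
    ∃ k : ℕ → ι → ι → ℕ, (∀ m a, k m a a = 0) ∧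
      Tendsto (fun (m : ℕ) a b => PairIsing.decorK (1 / ((m : ℝ) + 1)) * (k m a b : ℝ)) atTop
        (𝓝 (PairIsing.offDiag c)) := by
  refine ⟨fun (m : ℕ) a b => if a = b then 0 else ⌊c a b / PairIsing.decorK (1 / ((m : ℝ) + 1))⌋₊,
    fun m a => by simp, ?_⟩
  rw [tendsto_pi_nhds]
  intro a
  rw [tendsto_pi_nhds]
  intro b
  by_cases hab : a = b
  · simp only [PairIsing.offDiag, if_pos hab, Nat.cast_zero, mul_zero]
    exact tendsto_const_nhds
  · simp only [PairIsing.offDiag, if_neg hab]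
    exact PairIsing.tendsto_decorK_mul_floor (hc a b hab)

/-- **The Lieb–Simon inequality for a general ferromagnetic pair interaction on a finite set**
(two-sided form): for `c ≥ 0` off the diagonal, `a ∈ B`, `z ∉ B`,
`⟨σ_aσ_z⟩_c ≤ ∑_{u ∈ B} ∑_{v ∉ B} (c_{uv} + c_{vu}) ⟨σ_aσ_u⟩_{c|_B} (⟨σ_uσ_z⟩_c + ⟨σ_vσ_z⟩_c)`
(the weight is `exp(∑_{a,b} c_{ab}σ_aσ_b)`, so `c_{uv} + c_{vu}` is the coupling of the pair `{u,v}`;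
Simon 1980 / Lieb 1980 have the outer factor `⟨σ_vσ_z⟩` only). Decorated couplings
`PairIsing.liebSimon_decor`, `K_m⌊c/K_m⌋₊ → c`, `tanh² ≤ (1 + tanh²)K`, and continuity of all averages
in the couplings. [cite: AizenmanDuminilCopinAnnals2021, Lemma 5.7] -/
theorem PairIsing.liebSimon (c : ι → ι → ℝ) (hc : ∀ a b, a ≠ b → 0 ≤ c a b) (B : Finset ι)
    {a z : ι} (ha : a ∈ B) (hz : z ∉ B) :
    PairIsing.avg c (spinPair a z) ≤
      ∑ u : ↥B, ∑ v ∈ Bᶜ, (c u v + c v u) *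
        PairIsing.avg (fun a' b' : ↥B => c a' b') (spinPair ⟨a, ha⟩ u) *
        (PairIsing.avg c (spinPair (u : ι) z) + PairIsing.avg c (spinPair v z)) := by
  classical
  obtain ⟨k, hk, hconv⟩ := PairIsing.exists_decor_approx_explicit c hc
  set β₀ : ℕ → ℝ := fun m => 1 / ((m : ℝ) + 1) with hβ₀def
  set cm : ℕ → ι → ι → ℝ := fun m a b => PairIsing.decorK (β₀ m) * (k m a b : ℝ) with hcm
  have hconv' : Tendsto cm atTop (𝓝 (PairIsing.offDiag c)) := hconv
  have hβ₀ : ∀ m, 0 ≤ β₀ m := fun m => by positivity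
  have hβ₀0 : Tendsto β₀ atTop (𝓝 0) := tendsto_one_div_add_atTop_nhds_zero_nat
  have htanh : Tendsto (fun m => Real.tanh (β₀ m)) atTop (𝓝 0) := by
    have hct : Continuous Real.tanh := by
      have : Real.tanh = fun x => Real.sinh x / Real.cosh x := funext Real.tanh_eq_sinh_div_cosh
      rw [this]
      exact Real.continuous_sinh.div Real.continuous_cosh fun x => (Real.cosh_pos x).ne'
    have h : Tendsto (fun m => Real.tanh (β₀ m)) atTop (𝓝 (Real.tanh 0)) := (hct.tendsto 0).comp hβ₀0
    rwa [Real.tanh_zero] at h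
  have hcm0 : ∀ m a b, 0 ≤ cm m a b := fun m a b =>
    mul_nonneg (PairIsing.decorK_nonneg _) (Nat.cast_nonneg _)
  -- averages converge
  have havg : ∀ f, Tendsto (fun m => PairIsing.avg (cm m) f) atTop
      (𝓝 (PairIsing.avg (PairIsing.offDiag c) f)) :=
    fun f => ((PairIsing.continuous_avg f).tendsto _).comp hconv'
  have hcont : Continuous (fun F : ι → ι → ℝ => fun a' b' : ↥B => F a' b') :=
    continuous_pi fun a' => continuous_pi fun b' =>
      (continuous_apply (b' : ι)).comp (continuous_apply (a' : ι))
  have hres : Tendsto (fun m => fun a' b' : ↥B => cm m a' b') atTop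
      (𝓝 (fun a' b' : ↥B => PairIsing.offDiag c a' b')) := (hcont.tendsto _).comp hconv'
  have havgB : ∀ f, Tendsto (fun m => PairIsing.avg (fun a' b' : ↥B => cm m a' b') f) atTop
      (𝓝 (PairIsing.avg (fun a' b' : ↥B => PairIsing.offDiag c a' b') f)) :=
    fun f => ((PairIsing.continuous_avg f).tendsto _).comp hres
  have hoff : ∀ f, PairIsing.avg (PairIsing.offDiag c) f = PairIsing.avg c f :=
    fun f => PairIsing.avg_offDiag c f
  have hoffB : ∀ f, PairIsing.avg (fun a' b' : ↥B => PairIsing.offDiag c a' b') f =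
      PairIsing.avg (fun a' b' : ↥B => c a' b') f := by
    intro f
    have : (fun a' b' : ↥B => PairIsing.offDiag c a' b') = PairIsing.offDiag (fun a' b' : ↥B => c a' b') := by
      funext a' b'
      simp only [PairIsing.offDiag, Subtype.ext_iff]
    rw [this, PairIsing.avg_offDiag]
  -- the inequality at level `m`
  have hm : ∀ m, PairIsing.avg (cm m) (spinPair a z) ≤ (1 + Real.tanh (β₀ m) ^ 2) *
      ∑ u : ↥B, ∑ v ∈ Bᶜ, (cm m u v + cm m v u) *
        PairIsing.avg (fun a' b' : ↥B => cm m a' b') (spinPair ⟨a, ha⟩ u) *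
        (PairIsing.avg (cm m) (spinPair (u : ι) z) + PairIsing.avg (cm m) (spinPair v z)) := by
    intro m
    refine (PairIsing.liebSimon_decor (hk m) (hβ₀ m) B ha hz).trans ?_
    rw [Finset.mul_sum]
    refine Finset.sum_le_sum fun u _ => ?_
    rw [Finset.mul_sum]
    refine Finset.sum_le_sum fun v _ => ?_
    have hA : 0 ≤ PairIsing.avg (fun a' b' : ↥B => cm m a' b') (spinPair ⟨a, ha⟩ u) :=
      (PairIsing.avg_spinPair_mem _ (fun _ _ => hcm0 m _ _) _ _).1
    have hS : 0 ≤ PairIsing.avg (cm m) (spinPair (u : ι) z) + PairIsing.avg (cm m) (spinPair v z) :=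
      add_nonneg (PairIsing.avg_spinPair_mem _ (hcm0 m) _ _).1 (PairIsing.avg_spinPair_mem _ (hcm0 m) _ _).1
    have hkey : ((k m u v + k m v u : ℕ) : ℝ) * Real.tanh (β₀ m) ^ 2 ≤
        (1 + Real.tanh (β₀ m) ^ 2) * (cm m u v + cm m v u) := by
      have ht := tanh_sq_le_mul_decorK (β₀ m)
      have hk0 : (0 : ℝ) ≤ (k m u v + k m v u : ℕ) := Nat.cast_nonneg _
      calc ((k m u v + k m v u : ℕ) : ℝ) * Real.tanh (β₀ m) ^ 2
          ≤ ((k m u v + k m v u : ℕ) : ℝ) * ((1 + Real.tanh (β₀ m) ^ 2) * PairIsing.decorK (β₀ m)) :=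
            mul_le_mul_of_nonneg_left ht hk0
        _ = (1 + Real.tanh (β₀ m) ^ 2) * (cm m u v + cm m v u) := by
            simp only [hcm]; push_cast; ring
    calc ((k m u v + k m v u : ℕ) : ℝ) * Real.tanh (β₀ m) ^ 2 *
          PairIsing.avg (fun a' b' : ↥B => PairIsing.decorK (β₀ m) * (k m a' b' : ℝ)) (spinPair ⟨a, ha⟩ u) *
          (PairIsing.avg (fun a b => PairIsing.decorK (β₀ m) * (k m a b : ℝ)) (spinPair (u : ι) z) +
            PairIsing.avg (fun a b => PairIsing.decorK (β₀ m) * (k m a b : ℝ)) (spinPair v z))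
        = (((k m u v + k m v u : ℕ) : ℝ) * Real.tanh (β₀ m) ^ 2) *
            (PairIsing.avg (fun a' b' : ↥B => cm m a' b') (spinPair ⟨a, ha⟩ u) *
              (PairIsing.avg (cm m) (spinPair (u : ι) z) + PairIsing.avg (cm m) (spinPair v z))) := by
          simp only [hcm]; ring
      _ ≤ ((1 + Real.tanh (β₀ m) ^ 2) * (cm m u v + cm m v u)) *
            (PairIsing.avg (fun a' b' : ↥B => cm m a' b') (spinPair ⟨a, ha⟩ u) *
              (PairIsing.avg (cm m) (spinPair (u : ι) z) + PairIsing.avg (cm m) (spinPair v z))) :=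
          mul_le_mul_of_nonneg_right hkey (mul_nonneg hA hS)
      _ = _ := by ring
  -- pass to the limit
  have hl : Tendsto (fun m => PairIsing.avg (cm m) (spinPair a z)) atTop
      (𝓝 (PairIsing.avg c (spinPair a z))) := by
    rw [← hoff]; exact havg _
  have hcuv : ∀ u v : ι, Tendsto (fun m => cm m u v) atTop (𝓝 (PairIsing.offDiag c u v)) :=
    fun u v => tendsto_pi_nhds.1 (tendsto_pi_nhds.1 hconv' u) v
  have hr : Tendsto (fun m => (1 + Real.tanh (β₀ m) ^ 2) *
      ∑ u : ↥B, ∑ v ∈ Bᶜ, (cm m u v + cm m v u) *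
        PairIsing.avg (fun a' b' : ↥B => cm m a' b') (spinPair ⟨a, ha⟩ u) *
        (PairIsing.avg (cm m) (spinPair (u : ι) z) + PairIsing.avg (cm m) (spinPair v z))) atTop
      (𝓝 ((1 + (0 : ℝ) ^ 2) *
        ∑ u : ↥B, ∑ v ∈ Bᶜ, (PairIsing.offDiag c u v + PairIsing.offDiag c v u) *
          PairIsing.avg (fun a' b' : ↥B => PairIsing.offDiag c a' b') (spinPair ⟨a, ha⟩ u) *
          (PairIsing.avg (PairIsing.offDiag c) (spinPair (u : ι) z) +
            PairIsing.avg (PairIsing.offDiag c) (spinPair v z)))) :=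
    (tendsto_const_nhds.add (htanh.pow 2)).mul (tendsto_finsetSum _ fun u _ =>
      tendsto_finsetSum _ fun v _ =>
        ((((hcuv u v).add (hcuv v u)).mul (havgB _)).mul ((havg _).add (havg _))))
  have hlim := le_of_tendsto_of_tendsto' hl hr hm
  rw [zero_pow two_ne_zero, add_zero, one_mul] at hlim
  refine hlim.trans (le_of_eq ?_)
  refine Finset.sum_congr rfl fun u _ => Finset.sum_congr rfl fun v hv => ?_
  have huv : (u : ι) ≠ v := fun h => (Finset.mem_compl.1 hv) (h ▸ u.2)
  rw [hoffB, hoff, hoff]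
  simp only [PairIsing.offDiag, if_neg huv, if_neg (Ne.symm huv)]

/-- Griffiths' volume monotonicity on the decorated graph: the decorated model of `k|_B` is
dominated by that of `k` on two-point functions (`isingCorr_free_le_of_subset`). [folklore] -/
theorem PairIsing.avg_restrict_spinPair_le_decor {k : ι → ι → ℕ} (hk : ∀ a, k a a = 0)
    {β₀ : ℝ} (hβ₀ : 0 ≤ β₀) (B : Finset ι) (a b : ↥B) :
    PairIsing.avg (fun a' b' : ↥B => PairIsing.decorK β₀ * k a' b') (spinPair a b) ≤
      PairIsing.avg (fun a b => PairIsing.decorK β₀ * k a b) (spinPair (a : ι) b) := by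
  classical
  obtain ⟨S', hmem_inl, -, -, hTS⟩ := PairIsing.decor_restrict_transport hk β₀ B
  rw [← hTS a b, ← isingTwoPoint_decorGraph_inl hk β₀ (a : ι) b]
  by_cases hab : (a : ι) = b
  · rw [show (Sum.inl (b : ι) : ι ⊕ PairIsing.Decor k) = Sum.inl (a : ι) by rw [hab],
      isingTwoPoint_self, isingTwoPoint_self]
  · have hne : (Sum.inl (a : ι) : ι ⊕ PairIsing.Decor k) ≠ Sum.inl (b : ι) := by
      simpa using hab
    have hsp : spinPair (Sum.inl (a : ι) : ι ⊕ PairIsing.Decor k) (Sum.inl (b : ι)) =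
        spinProduct ({Sum.inl (a : ι), Sum.inl (b : ι)} : Finset (ι ⊕ PairIsing.Decor k)) := by
      funext σ
      simp [spinPair, spinProduct, Finset.prod_insert, hne]
    unfold isingTwoPoint
    rw [hsp]
    refine isingCorr_free_le_of_subset (PairIsing.decorGraph k) hβ₀ le_rfl ?_ (Finset.subset_univ S')
    intro x hx
    simp only [Finset.mem_insert, Finset.mem_singleton] at hx
    rcases hx with rfl | rfl
    · exact (hmem_inl _).2 a.2
    · exact (hmem_inl _).2 b.2

/-- **Griffiths' monotonicity for pair interactions: restricting the couplings to `B` decreases the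
two-point functions**, `⟨σ_aσ_b⟩_{c|_B} ≤ ⟨σ_aσ_b⟩_c` for `c ≥ 0` off the diagonal and `a, b ∈ B`
(decorated couplings and continuity). [cite: FriedliVelenik2017, Exercise 3.12] -/
theorem PairIsing.avg_restrict_spinPair_le (c : ι → ι → ℝ) (hc : ∀ a b, a ≠ b → 0 ≤ c a b)
    (B : Finset ι) (a b : ↥B) :
    PairIsing.avg (fun a' b' : ↥B => c a' b') (spinPair a b) ≤ PairIsing.avg c (spinPair (a : ι) b) := by
  classical
  obtain ⟨k, hk, hconv⟩ := PairIsing.exists_decor_approx_explicit c hc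
  set cm : ℕ → ι → ι → ℝ := fun m a b => PairIsing.decorK (1 / ((m : ℝ) + 1)) * (k m a b : ℝ) with hcm
  have hconv' : Tendsto cm atTop (𝓝 (PairIsing.offDiag c)) := hconv
  have hcont : Continuous (fun F : ι → ι → ℝ => fun a' b' : ↥B => F a' b') :=
    continuous_pi fun a' => continuous_pi fun b' =>
      (continuous_apply (b' : ι)).comp (continuous_apply (a' : ι))
  have hl : Tendsto (fun m => PairIsing.avg (fun a' b' : ↥B => cm m a' b') (spinPair a b)) atTop
      (𝓝 (PairIsing.avg (fun a' b' : ↥B => PairIsing.offDiag c a' b') (spinPair a b))) :=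
    ((PairIsing.continuous_avg _).tendsto _).comp ((hcont.tendsto _).comp hconv')
  have hr : Tendsto (fun m => PairIsing.avg (cm m) (spinPair (a : ι) b)) atTop
      (𝓝 (PairIsing.avg (PairIsing.offDiag c) (spinPair (a : ι) b))) :=
    ((PairIsing.continuous_avg _).tendsto _).comp hconv'
  have hlim := le_of_tendsto_of_tendsto' hl hr fun m =>
    PairIsing.avg_restrict_spinPair_le_decor (hk m) (by positivity) B a b
  have hoffB : (fun a' b' : ↥B => PairIsing.offDiag c a' b') = PairIsing.offDiag (fun a' b' : ↥B => c a' b') := by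
    funext a' b'
    simp only [PairIsing.offDiag, Subtype.ext_iff]
  rwa [hoffB, PairIsing.avg_offDiag, PairIsing.avg_offDiag] at hlim

/-- **The Lieb–Simon inequality with the full state in the first factor** (the form printed in
Aizenman–Duminil-Copin 2021, Lemma 5.7, eq. (5.22), up to the two-sided outer factor):
`⟨σ_aσ_z⟩_c ≤ ∑_{u ∈ B} ∑_{v ∉ B} (c_{uv} + c_{vu}) ⟨σ_aσ_u⟩_c (⟨σ_uσ_z⟩_c + ⟨σ_vσ_z⟩_c)`.
[cite: AizenmanDuminilCopinAnnals2021, Lemma 5.7, eq. (5.22)] -/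
theorem PairIsing.liebSimon_full (c : ι → ι → ℝ) (hc : ∀ a b, a ≠ b → 0 ≤ c a b) (B : Finset ι)
    {a z : ι} (ha : a ∈ B) (hz : z ∉ B) :
    PairIsing.avg c (spinPair a z) ≤
      ∑ u ∈ B, ∑ v ∈ Bᶜ, (c u v + c v u) * PairIsing.avg c (spinPair a u) *
        (PairIsing.avg c (spinPair u z) + PairIsing.avg c (spinPair v z)) := by
  classical
  refine (PairIsing.liebSimon c hc B ha hz).trans ?_
  rw [← Finset.sum_coe_sort B]
  refine Finset.sum_le_sum fun u _ => Finset.sum_le_sum fun v hv => ?_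
  have huv : (u : ι) ≠ v := fun h => (Finset.mem_compl.1 hv) (h ▸ u.2)
  have hcuv : 0 ≤ c u v + c v u := add_nonneg (hc _ _ huv) (hc _ _ (Ne.symm huv))
  have hoc : ∀ a b, 0 ≤ PairIsing.offDiag c a b := fun a b => by
    by_cases h : a = b
    · simp [PairIsing.offDiag, h]
    · simp only [PairIsing.offDiag, if_neg h]; exact hc a b h
  have hS : 0 ≤ PairIsing.avg c (spinPair (u : ι) z) + PairIsing.avg c (spinPair v z) := by
    rw [← PairIsing.avg_offDiag c, ← PairIsing.avg_offDiag c]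
    exact add_nonneg (PairIsing.avg_spinPair_mem _ hoc _ _).1 (PairIsing.avg_spinPair_mem _ hoc _ _).1
  have hmono := PairIsing.avg_restrict_spinPair_le c hc B ⟨a, ha⟩ u
  calc (c u v + c v u) * PairIsing.avg (fun a' b' : ↥B => c a' b') (spinPair ⟨a, ha⟩ u) *
        (PairIsing.avg c (spinPair (u : ι) z) + PairIsing.avg c (spinPair v z))
      ≤ (c u v + c v u) * PairIsing.avg c (spinPair a u) *
        (PairIsing.avg c (spinPair (u : ι) z) + PairIsing.avg c (spinPair v z)) :=
        mul_le_mul_of_nonneg_right (mul_le_mul_of_nonneg_left hmono hcuv) hS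
    _ = _ := rfl

end PairIsingLiebSimon

end Literature.Probability.LatticeModels
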